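import Mathlib
import Literature.Analysis.ODE.GlobalExistence
import Literature.Barriers.NavierStokesRegularity.DyadicCascadeRegularityProofs
import Literature.Barriers.NavierStokesRegularity.DyadicCascadePositivity
import HarnessLib

/-!
# The viscous dyadic model: truncated systems and global existence of weak solutions
  (Cheskidov 2008, Thm. 4.1, for the Barbato–Morandin–Romito system; BMR 2011 §2 (2.2), §3)

Barrier catalogue `Literature/Barriers/NavierStokesRegularity/`, third **proof file** towards the
named fact `Dyadic.BarbatoMorandinRomito2011_thm1` (`DyadicCascadeRegularity`). Contents:

* **Truncated systems.** For a level `N` and a closure parameter `κ ≥ 0` the truncation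
  `T_N^κ` of (1.1) keeps the modes `1, …, N`, sets `X₀ = 0`, `X_{N+1} := κX_N` and all higher
  modes `0`. For `κ = 0` this is Cheskidov's Galerkin truncation (proof of Thm. 4.1: the `k`-th
  equation "without the term `u_ku_{k+1}`"); for `κ = λ^{-(β-2+ε)}` it is, in the original
  variables, BMR's truncation (2.2) of the rescaled system with the border convention
  `Y_{N+1}^{(N)} = Y_N^{(N)}`. `exists_truncated_solution`: for `ν ≥ 0`, `β ≠ 0` and a
  non-negative datum every `T_N^κ` has a global solution — a polynomial ODE in `Fin N → ℝ` fed to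
  the continuation principle `Literature.Analysis.ODE.exists_solution_Ici_of_apriori_bound`
  (Teschl 2012, Cor. 2.16), the a priori bound being positivity plus the decay of the truncated
  energy (`nonneg_of_modes_Icc`, `energy_le_of_modes_Icc`, local-in-time forms of the lemmas of
  `DyadicCascadePositivity`; the flux out of mode `N` is `-2κλ_N^βX_N³ ≤ 0`).
* **Passage to the limit** (`exists_weakSolution_of_truncated`, Cheskidov's proof of Thm. 4.1:
  uniform bounds, equicontinuity mode by mode, Ascoli–Arzelà and "a diagonalization process", the
  integral form of the equations passes to the limit, the limit modes are `C¹`): any family of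
  solutions of `T_N^κ`, `N → ∞`, with a common non-negative square-summable datum has a
  subsequence converging at every mode and every time `t ≥ 0` to a weak solution of (1.1)
  (BMR Def. 3.1, `IsBMRWeakSolution`). The extraction is `Dyadic.exists_subseq_tendsto` of
  `DyadicCascadeRegularityProofs`; the limit is identified through the integral equation by
  dominated convergence and differentiated by the fundamental theorem of calculus, exactly as in
  the proof of `Cheskidov2008_thm44_holds` there.
* **Global existence** (`exists_isBMRWeakSolution`): for `ν ≥ 0`, `β ≠ 0` and every datum with
  `xₙ ≥ 0`, `∑xₙ² < ∞` there is a weak solution of (1.1) on `[0, ∞)` with `X₀ ≡ 0` — the first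
  bullet of BMR §3 ("existence of global in time Leray–Hopf solutions for all initial conditions
  in `H`", from [Che08]) for non-negative data, which is the case Theorem 1 needs.

Theorem-only module (the truncation dictionary `Fin N → ℝ ↔ ℕ → ℝ` is a local definition inside
the proofs, as in `exists_galerkin_solution`).

## References

* A. Cheskidov, Trans. AMS 360 (2008) 5101–5120, §4 Thm. 4.1 and its proof. [`Cheskidov2008`]
* D. Barbato, F. Morandin, M. Romito, Nonlinearity 24 (2011) 3083–3097, §2 (2.2), §3 (facts from
  [Che08]), §3.2. [`BarbatoMorandinRomito2011`]
* G. Teschl, *Ordinary Differential Equations and Dynamical Systems*, GSM 140 (2012), Cor. 2.16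
  (via `Literature/Analysis/ODE/GlobalExistence`). [`Teschl2012`]
-/

noncomputable section

open Set Filter Metric MeasureTheory intervalIntegral
open scoped Topology BigOperators NNReal

namespace Literature.Barriers.NavierStokesRegularity.Dyadic

/-! ## Local-in-time positivity and energy decay -/

section Local

variable {ν β : ℝ} {X : ℕ → ℝ → ℝ} {N : ℕ} {s : ℝ}

/-- **Positivity on a finite horizon.** If the modes `1, …, N` of `X` solve (1.1) within `[0, s]`,
the mode `N + 1` is continuous on `[0, s]`, `β ≠ 0` and `Xₙ(0) ≥ 0` for `1 ≤ n ≤ N`, then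
`Xₙ(t) ≥ 0` on `[0, s]` for `1 ≤ n ≤ N` (same proof as `nonneg_of_modes`: variation of
constants for the linear equation of each mode). [cite: Cheskidov2008, §4 Thm. 4.2] -/
theorem nonneg_of_modes_Icc (hβ : β ≠ 0)
    (hd : ∀ m < N, ∀ t ∈ Icc 0 s,
      HasDerivWithinAt (X (m + 1)) (bmrRHS ν β (fun k => X k t) (m + 1)) (Icc 0 s) t)
    (hc : ContinuousOn (X (N + 1)) (Icc 0 s)) (h0 : ∀ m < N, 0 ≤ X (m + 1) 0) :
    ∀ m < N, ∀ t ∈ Icc 0 s, 0 ≤ X (m + 1) t := by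
  intro m hm t ht
  have hcont : ∀ k, 1 ≤ k → k ≤ N + 1 → ContinuousOn (X k) (Icc 0 s) := by
    intro k hk1 hk2
    rcases eq_or_lt_of_le hk2 with rfl | hlt
    · exact hc
    · obtain ⟨j, rfl⟩ : ∃ j, k = j + 1 := ⟨k - 1, by omega⟩
      exact fun τ hτ => (hd j (by omega) τ hτ).continuousWithinAt
  set A : ℝ → ℝ := fun τ => bmrLambda m ^ β * X m τ ^ 2 with hA
  set B : ℝ → ℝ := fun τ => -ν * bmrLambda (m + 1) ^ 2 - bmrLambda (m + 1) ^ β * X (m + 2) τ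
    with hB
  have hts : Icc 0 t ⊆ Icc 0 s := Icc_subset_Icc le_rfl ht.2
  have hAc : ContinuousOn A (Icc 0 t) := by
    rcases m with _ | m
    · have : A = fun _ => 0 := by funext τ; simp [hA, Real.zero_rpow hβ]
      rw [this]; exact continuousOn_const
    · exact (continuousOn_const.mul ((hcont (m + 1) (by omega) (by omega)).pow 2)).mono hts
  have hBc : ContinuousOn B (Icc 0 t) :=
    (continuousOn_const.sub (continuousOn_const.mul (hcont (m + 2) (by omega) (by omega)))).mono hts
  have hA0 : ∀ τ, 0 ≤ A τ := fun τ => mul_nonneg (bmrLambda_rpow_nonneg m β) (sq_nonneg _)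
  have hg : ContinuousOn (X (m + 1)) (Icc 0 t) := (hcont (m + 1) (by omega) (by omega)).mono hts
  have hg' : ∀ τ ∈ Ico 0 t, HasDerivWithinAt (X (m + 1)) (A τ + B τ * X (m + 1) τ) (Ici τ) τ := by
    intro τ hτ
    have hτs : τ ∈ Ico 0 s := ⟨hτ.1, hτ.2.trans_le ht.2⟩
    have h := (hd m hm τ (Ico_subset_Icc_self hτs)).mono_of_mem_nhdsWithin
      (Icc_mem_nhdsGE_of_mem hτs)
    rw [bmrRHS_succ_eq_linear] at h
    exact h
  have key := Literature.Analysis.ODE.linearComparison_le hg hg' hAc hBc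
    (fun τ _ => le_rfl) (right_mem_Icc.2 ht.1)
  refine le_trans (mul_nonneg (Real.exp_pos _).le (add_nonneg (h0 m hm) ?_)) key
  exact intervalIntegral.integral_nonneg ht.1 fun τ _ => mul_nonneg (hA0 τ) (Real.exp_pos _).le

/-- **Energy decay on a finite horizon.** If the modes `1, …, N` of `X` solve (1.1) within
`[0, s]`, the mode `N + 1` is continuous and non-negative on `[0, s]` and `β ≠ 0`, `ν ≥ 0`, then
the truncated energy does not increase: `∑_{n≤N} Xₙ(t)² ≤ ∑_{n≤N} Xₙ(0)²` on `[0, s]` (its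
derivative is `-2ν∑λₙ²Xₙ² - 2λ_N^βX_N²X_{N+1} ≤ 0`). [cite: Cheskidov2008, §4 Thm. 4.2] -/
theorem energy_le_of_modes_Icc (hβ : β ≠ 0) (hν : 0 ≤ ν)
    (hd : ∀ m < N, ∀ t ∈ Icc 0 s,
      HasDerivWithinAt (X (m + 1)) (bmrRHS ν β (fun k => X k t) (m + 1)) (Icc 0 s) t)
    (hpos : ∀ t ∈ Icc 0 s, 0 ≤ X (N + 1) t) :
    ∀ t ∈ Icc 0 s, ∑ m ∈ Finset.range N, X (m + 1) t ^ 2 ≤ ∑ m ∈ Finset.range N, X (m + 1) 0 ^ 2 := by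
  intro t ht
  have hderiv : ∀ τ ∈ Icc 0 s, HasDerivWithinAt (fun r => ∑ m ∈ Finset.range N, X (m + 1) r ^ 2)
      (-2 * ν * ∑ m ∈ Finset.range N, bmrLambda (m + 1) ^ 2 * X (m + 1) τ ^ 2 -
        2 * (bmrLambda N ^ β * X N τ ^ 2 * X (N + 1) τ)) (Icc 0 s) τ := by
    intro τ hτ
    exact (hasDerivWithinAt_bmrEnergy (fun m hm => hd m hm τ hτ)).congr_deriv
      (two_mul_sum_mul_bmrRHS ν hβ (fun k => X k τ) N)
  have hbound : ∀ τ ∈ Ico 0 s, -2 * ν * ∑ m ∈ Finset.range N, bmrLambda (m + 1) ^ 2 * X (m + 1) τ ^ 2 -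
      2 * (bmrLambda N ^ β * X N τ ^ 2 * X (N + 1) τ) ≤ 0 := by
    intro τ hτ
    have h1 : 0 ≤ ∑ m ∈ Finset.range N, bmrLambda (m + 1) ^ 2 * X (m + 1) τ ^ 2 :=
      Finset.sum_nonneg fun m _ => by positivity
    have h2 : 0 ≤ bmrLambda N ^ β * X N τ ^ 2 * X (N + 1) τ :=
      mul_nonneg (mul_nonneg (bmrLambda_rpow_nonneg _ _) (sq_nonneg _))
        (hpos τ (Ico_subset_Icc_self hτ))
    nlinarith
  have := le_add_mul_of_deriv_le_Icc hderiv hbound t ht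
  linarith

end Local

/-! ## Elementary properties of the right-hand side -/

/-- **Bound on the right-hand side**: if `|Xₖ| ≤ R` for all `k`, `ν ≥ 0`, then
`|RHS_{m+1}(X)| ≤ νλ_{m+1}²R + λ_m^βR² + λ_{m+1}^βR²` (the modewise Lipschitz-in-time bound of the
Galerkin approximations, as in Cheskidov's proof of Thm. 4.1). [cite: Cheskidov2008, §4 Thm. 4.1 (proof)] -/
theorem abs_bmrRHS_succ_le {ν β : ℝ} (hν : 0 ≤ ν) {u : ℕ → ℝ} {R : ℝ} (hR : 0 ≤ R)
    (hu : ∀ k, |u k| ≤ R) (m : ℕ) :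
    |bmrRHS ν β u (m + 1)| ≤
      ν * bmrLambda (m + 1) ^ 2 * R + bmrLambda m ^ β * R ^ 2 + bmrLambda (m + 1) ^ β * R ^ 2 := by
  rw [bmrRHS_succ]
  have hw2 : 0 ≤ bmrLambda (m + 1) ^ 2 := sq_nonneg _
  have hwm : 0 ≤ bmrLambda m ^ β := bmrLambda_rpow_nonneg _ _
  have hwm1 : 0 ≤ bmrLambda (m + 1) ^ β := bmrLambda_rpow_nonneg _ _
  have h1 : |(-ν) * bmrLambda (m + 1) ^ 2 * u (m + 1)| ≤ ν * bmrLambda (m + 1) ^ 2 * R := by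
    rw [abs_mul, abs_mul, abs_neg, abs_of_nonneg hν, abs_of_nonneg hw2]
    exact mul_le_mul_of_nonneg_left (hu _) (mul_nonneg hν hw2)
  have h2 : |bmrLambda m ^ β * u m ^ 2| ≤ bmrLambda m ^ β * R ^ 2 := by
    rw [abs_mul, abs_of_nonneg hwm, abs_of_nonneg (sq_nonneg _)]
    refine mul_le_mul_of_nonneg_left ?_ hwm
    rw [← sq_abs]
    exact pow_le_pow_left₀ (abs_nonneg _) (hu m) 2
  have h3 : |bmrLambda (m + 1) ^ β * u (m + 1) * u (m + 2)| ≤ bmrLambda (m + 1) ^ β * R ^ 2 := by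
    rw [abs_mul, abs_mul, abs_of_nonneg hwm1, mul_assoc, sq]
    exact mul_le_mul_of_nonneg_left (mul_le_mul (hu _) (hu _) (abs_nonneg _) hR) hwm1
  calc |(-ν) * bmrLambda (m + 1) ^ 2 * u (m + 1) + bmrLambda m ^ β * u m ^ 2 -
          bmrLambda (m + 1) ^ β * u (m + 1) * u (m + 2)|
      ≤ |(-ν) * bmrLambda (m + 1) ^ 2 * u (m + 1) + bmrLambda m ^ β * u m ^ 2| +
          |bmrLambda (m + 1) ^ β * u (m + 1) * u (m + 2)| := abs_sub _ _
    _ ≤ |(-ν) * bmrLambda (m + 1) ^ 2 * u (m + 1)| + |bmrLambda m ^ β * u m ^ 2| +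
          |bmrLambda (m + 1) ^ β * u (m + 1) * u (m + 2)| := by
        gcongr
        exact abs_add_le _ _
    _ ≤ _ := by linarith

/-- The right-hand side at a fixed mode is continuous on a set along modes continuous there. [folklore] -/
theorem continuousOn_bmrRHS_succ {ν β : ℝ} {U : ℕ → ℝ → ℝ} {S : Set ℝ}
    (h : ∀ k, ContinuousOn (U k) S) (m : ℕ) :
    ContinuousOn (fun τ => bmrRHS ν β (fun k => U k τ) (m + 1)) S := by
  simp only [bmrRHS_succ]
  exact ((continuousOn_const.mul (h _)).add (continuousOn_const.mul ((h _).pow 2))).sub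
    ((continuousOn_const.mul (h _)).mul (h _))

/-- The right-hand side at a fixed mode is continuous along continuous modes. [folklore] -/
theorem continuous_bmrRHS_succ {ν β : ℝ} {U : ℕ → ℝ → ℝ} (h : ∀ k, Continuous (U k)) (m : ℕ) :
    Continuous (fun τ => bmrRHS ν β (fun k => U k τ) (m + 1)) := by
  simp only [bmrRHS_succ]
  exact ((continuous_const.mul (h _)).add (continuous_const.mul ((h _).pow 2))).sub
    ((continuous_const.mul (h _)).mul (h _))

/-- The right-hand side at a fixed mode converges under modewise convergence of the states. [folklore] -/
theorem tendsto_bmrRHS_succ {ν β : ℝ} {ι : Type*} {l : Filter ι} {F : ι → ℕ → ℝ} {v : ℕ → ℝ}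
    (h : ∀ k, Tendsto (fun j => F j k) l (𝓝 (v k))) (m : ℕ) :
    Tendsto (fun j => bmrRHS ν β (F j) (m + 1)) l (𝓝 (bmrRHS ν β v (m + 1))) := by
  simp only [bmrRHS_succ]
  exact ((tendsto_const_nhds.mul (h _)).add (tendsto_const_nhds.mul ((h _).pow 2))).sub
    ((tendsto_const_nhds.mul (h _)).mul (h _))

/-! ## Global solutions of the truncated systems -/

/-- **Global existence for the truncated system `T_N^κ`** (Cheskidov 2008, proof of Thm. 4.1:
"from the theory of ordinary differential equations we know that there exists a unique solution
`u^k(t)` to (galerkin) on `[0,∞)`"; BMR 2011, (2.2)). For `ν ≥ 0`, `β ≠ 0`, `κ ≥ 0`, a level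
`N` and a datum with `xₙ ≥ 0` (`n ≥ 1`) there is `X : ℕ → ℝ → ℝ` with `X₀ ≡ 0`,
`X_{N+1} ≡ κX_N`, `Xₙ ≡ 0` for `n ≥ N + 2`, `Xₙ(0) = xₙ` for `1 ≤ n ≤ N`, and the modes
`1, …, N` solving (1.1) on `[0, ∞)` (one-sided at `0`). Proof: a polynomial (hence `C¹`,
Lipschitz on balls) vector field on `Fin N → ℝ`; every local solution is non-negative
(`nonneg_of_modes_Icc`) so its truncated energy does not increase (`energy_le_of_modes_Icc`, the
flux out of mode `N` being `-2κλ_N^βX_N³ ≤ 0`), which is an a priori bound in the sup norm;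
the continuation principle `exists_solution_Ici_of_apriori_bound` applies.
[cite: Cheskidov2008, §4 Thm. 4.1 (proof)] [cite: BarbatoMorandinRomito2011, §2 (2.2)] [cite: Teschl2012, Cor. 2.16] -/
theorem exists_truncated_solution {ν β κ : ℝ} (hν : 0 ≤ ν) (hβ : β ≠ 0) (hκ : 0 ≤ κ) (x : ℕ → ℝ)
    (hx : ∀ n, 1 ≤ n → 0 ≤ x n) (N : ℕ) :
    ∃ X : ℕ → ℝ → ℝ, (∀ t, X 0 t = 0) ∧ (∀ t, X (N + 1) t = κ * X N t) ∧
      (∀ n, N + 2 ≤ n → ∀ t, X n t = 0) ∧ (∀ m < N, X (m + 1) 0 = x (m + 1)) ∧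
      ∀ m < N, ∀ t, 0 ≤ t →
        HasDerivWithinAt (X (m + 1)) (bmrRHS ν β (fun k => X k t) (m + 1)) (Ici 0) t := by
  -- the dictionary `Fin N → ℝ` ↔ sequences, with the closure `X_{N+1} = κ X_N`
  let core : (Fin N → ℝ) → ℕ → ℝ := fun c m => if h : 1 ≤ m ∧ m ≤ N then c ⟨m - 1, by omega⟩ else 0
  let toSeq : (Fin N → ℝ) → ℕ → ℝ := fun c m => if m = N + 1 then κ * core c N else core c m
  have hcore_succ : ∀ (c : Fin N → ℝ) (m : ℕ) (hm : m < N), core c (m + 1) = c ⟨m, hm⟩ := by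
    intro c m hm
    simp only [core, dif_pos (show 1 ≤ m + 1 ∧ m + 1 ≤ N from ⟨by omega, by omega⟩),
      Nat.add_sub_cancel]
  have hcore_zero : ∀ c : Fin N → ℝ, core c 0 = 0 := fun c => by simp [core]
  have hcore_gt : ∀ (c : Fin N → ℝ) (m : ℕ), N < m → core c m = 0 := fun c m hm => by
    simp only [core, dif_neg (show ¬(1 ≤ m ∧ m ≤ N) by omega)]
  have htoSeq_succ : ∀ (c : Fin N → ℝ) (m : ℕ) (hm : m < N), toSeq c (m + 1) = c ⟨m, hm⟩ := by
    intro c m hm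
    simp only [toSeq, if_neg (show m + 1 ≠ N + 1 by omega), hcore_succ c m hm]
  have htoSeq_zero : ∀ c : Fin N → ℝ, toSeq c 0 = 0 := fun c => by
    simp only [toSeq, if_neg (show (0 : ℕ) ≠ N + 1 by omega), hcore_zero]
  have htoSeq_N1 : ∀ c : Fin N → ℝ, toSeq c (N + 1) = κ * toSeq c N := by
    intro c
    rcases Nat.eq_zero_or_pos N with h0 | hN
    · subst h0; simp [toSeq, hcore_zero]
    · simp only [toSeq, if_true, if_neg (show N ≠ N + 1 by omega)]
  have htoSeq_gt : ∀ (c : Fin N → ℝ) (m : ℕ), N + 2 ≤ m → toSeq c m = 0 := fun c m hm => by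
    simp only [toSeq, if_neg (show m ≠ N + 1 by omega), hcore_gt c m (by omega)]
  -- the vector field
  let V : ℝ → (Fin N → ℝ) → (Fin N → ℝ) := fun _ c i => bmrRHS ν β (toSeq c) (i + 1)
  have hcoreCD : ∀ m : ℕ, ContDiff ℝ 1 fun c : Fin N → ℝ => core c m := by
    intro m
    by_cases hm : 1 ≤ m ∧ m ≤ N
    · have : (fun c : Fin N → ℝ => core c m) = fun c => c ⟨m - 1, by omega⟩ := by
        funext c; simp only [core, dif_pos hm]
      rw [this]
      exact contDiff_apply ℝ ℝ (⟨m - 1, by omega⟩ : Fin N)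
    · have : (fun c : Fin N → ℝ => core c m) = fun _ => 0 := by
        funext c; simp only [core, dif_neg hm]
      rw [this]
      exact contDiff_const
  have hcoord : ∀ m : ℕ, ContDiff ℝ 1 fun c : Fin N → ℝ => toSeq c m := by
    intro m
    by_cases hm : m = N + 1
    · have : (fun c : Fin N → ℝ => toSeq c m) = fun c => κ * core c N := by
        funext c; simp only [toSeq, if_pos hm]
      rw [this]
      exact contDiff_const.mul (hcoreCD N)
    · have : (fun c : Fin N → ℝ => toSeq c m) = fun c => core c m := by
        funext c; simp only [toSeq, if_neg hm]
      rw [this]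
      exact hcoreCD m
  have hV : ContDiff ℝ 1 (V 0) := by
    refine contDiff_pi.2 fun i => ?_
    show ContDiff ℝ 1 fun c : Fin N → ℝ => bmrRHS ν β (toSeq c) (i + 1)
    simp only [bmrRHS_succ]
    exact (((contDiff_const.mul (hcoord _)).add (contDiff_const.mul ((hcoord _).pow 2))).sub
      ((contDiff_const.mul (hcoord _)).mul (hcoord _)))
  have hlip : ∀ T ρ : ℝ, ∃ K : ℝ≥0, ∀ t ∈ Icc 0 T, LipschitzOnWith K (V t) (closedBall 0 ρ) := by
    intro T ρ
    obtain ⟨K, hK⟩ := hV.contDiffOn.exists_lipschitzOnWith one_ne_zero (convex_closedBall 0 ρ)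
      (isCompact_closedBall 0 ρ)
    exact ⟨K, fun t _ => hK⟩
  have hcont : ∀ c : Fin N → ℝ, ContinuousOn (fun t => V t c) (Ici 0) := fun c => continuousOn_const
  -- the datum and the energy level
  let x₀ : Fin N → ℝ := fun i => x (i + 1)
  set E0 : ℝ := ∑ m ∈ Finset.range N, x (m + 1) ^ 2 with hE0
  have hE0nn : 0 ≤ E0 := Finset.sum_nonneg fun m _ => sq_nonneg _
  -- from a solution in the phase space to a solution in sequences
  have dict : ∀ (S : Set ℝ) (γ : ℝ → Fin N → ℝ),
      (∀ t ∈ S, HasDerivWithinAt γ (V t (γ t)) S t) →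
      ∀ m < N, ∀ t ∈ S, HasDerivWithinAt (fun τ => toSeq (γ τ) (m + 1))
        (bmrRHS ν β (fun k => toSeq (γ t) k) (m + 1)) S t := by
    intro S γ hγ m hm t ht
    have h := hasDerivWithinAt_pi.1 (hγ t ht) ⟨m, hm⟩
    have heq : (fun τ => toSeq (γ τ) (m + 1)) = fun τ => γ τ ⟨m, hm⟩ := by
      funext τ; exact htoSeq_succ (γ τ) m hm
    rw [heq]
    exact h
  -- a priori bound: positivity and energy decay for local solutions
  have hapriori : ∀ T : ℝ, 0 ≤ T → ∃ R : ℝ, ‖x₀‖ ≤ R ∧ ∀ s ∈ Icc 0 T, ∀ γ : ℝ → Fin N → ℝ,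
      γ 0 = x₀ → (∀ t ∈ Icc 0 s, HasDerivWithinAt γ (V t (γ t)) (Icc 0 s) t) →
      ∀ t ∈ Icc 0 s, ‖γ t‖ ≤ R := by
    intro T _
    set R : ℝ := Real.sqrt E0 with hR
    have hR0 : 0 ≤ R := Real.sqrt_nonneg _
    refine ⟨R, ?_, ?_⟩
    · rw [pi_norm_le_iff_of_nonneg hR0]
      intro i
      rw [Real.norm_eq_abs, hR]
      refine Real.abs_le_sqrt ?_
      exact Finset.single_le_sum (f := fun m => x (m + 1) ^ 2) (fun m _ => sq_nonneg _)
        (Finset.mem_range.2 i.2)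
    · intro s _ γ hγ0 hγ t ht
      -- the associated sequence solution on `[0, s]`
      set U : ℕ → ℝ → ℝ := fun k τ => toSeq (γ τ) k with hU
      have hd' : ∀ m < N, ∀ τ ∈ Icc 0 s, HasDerivWithinAt (U (m + 1))
          (bmrRHS ν β (fun k => U k τ) (m + 1)) (Icc 0 s) τ := dict (Icc 0 s) γ hγ
      have hinit : ∀ m < N, U (m + 1) 0 = x (m + 1) := by
        intro m hm
        show toSeq (γ 0) (m + 1) = x (m + 1)
        rw [htoSeq_succ _ _ hm, hγ0]
      have hUN1 : ∀ τ, U (N + 1) τ = κ * U N τ := fun τ => htoSeq_N1 (γ τ)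
      -- continuity of mode `N + 1 = κ · mode N`
      have hcN : ContinuousOn (U N) (Icc 0 s) := by
        rcases Nat.eq_zero_or_pos N with h0 | hN
        · have : U N = fun _ => 0 := by
            funext τ; rw [h0]; exact htoSeq_zero (γ τ)
          rw [this]; exact continuousOn_const
        · obtain ⟨M, hM⟩ : ∃ M, N = M + 1 := ⟨N - 1, by omega⟩
          intro τ hτ
          have := (hd' M (by omega) τ hτ).continuousWithinAt
          rwa [← hM] at this
      have hcN1 : ContinuousOn (U (N + 1)) (Icc 0 s) := by
        have : U (N + 1) = fun τ => κ * U N τ := funext hUN1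
        rw [this]; exact continuousOn_const.mul hcN
      have hpos : ∀ m < N, ∀ τ ∈ Icc 0 s, 0 ≤ U (m + 1) τ :=
        nonneg_of_modes_Icc hβ hd' hcN1 fun m hm => by rw [hinit m hm]; exact hx (m + 1) (by omega)
      have hposN1 : ∀ τ ∈ Icc 0 s, 0 ≤ U (N + 1) τ := by
        intro τ hτ
        rw [hUN1]
        rcases Nat.eq_zero_or_pos N with h0 | hN
        · have : U N τ = 0 := by rw [h0]; exact htoSeq_zero (γ τ)
          rw [this, mul_zero]
        · obtain ⟨M, hM⟩ : ∃ M, N = M + 1 := ⟨N - 1, by omega⟩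
          have := hpos M (by omega) τ hτ
          rw [← hM] at this
          exact mul_nonneg hκ this
      have hen := energy_le_of_modes_Icc hβ hν hd' hposN1 t ht
      have hinitE : ∑ m ∈ Finset.range N, U (m + 1) 0 ^ 2 = E0 :=
        Finset.sum_congr rfl fun m hm => by rw [hinit m (Finset.mem_range.1 hm)]
      rw [hinitE] at hen
      rw [pi_norm_le_iff_of_nonneg hR0]
      intro i
      rw [Real.norm_eq_abs, hR]
      refine Real.abs_le_sqrt ?_
      have h1 : γ t i ^ 2 ≤ ∑ m ∈ Finset.range N, U (m + 1) t ^ 2 := by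
        have := Finset.single_le_sum (f := fun m => U (m + 1) t ^ 2)
          (fun m _ => sq_nonneg _) (Finset.mem_range.2 i.2)
        simp only [hU, htoSeq_succ _ _ i.2] at this
        simpa only [hU] using this
      exact h1.trans hen
  obtain ⟨γ, hγ0, -, hγ, -⟩ :=
    Literature.Analysis.ODE.exists_solution_Ici_of_apriori_bound hlip hcont hapriori
  refine ⟨fun m t => toSeq (γ t) m, fun t => htoSeq_zero _, fun t => htoSeq_N1 _,
    fun n hn t => htoSeq_gt _ _ hn, ?_, ?_⟩
  · intro m hm
    show toSeq (γ 0) (m + 1) = x (m + 1)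
    rw [htoSeq_succ _ _ hm, hγ0]
  · intro m hm t ht
    have h := hasDerivWithinAt_pi.1 (hγ t ht) ⟨m, hm⟩
    have heq : (fun τ => toSeq (γ τ) (m + 1)) = fun τ => γ τ ⟨m, hm⟩ := by
      funext τ; exact htoSeq_succ (γ τ) m hm
    show HasDerivWithinAt (fun τ => toSeq (γ τ) (m + 1)) _ (Ici 0) t
    rw [heq]
    exact h

/-! ## Passage to the limit -/

/-- **From truncations to a weak solution** (Cheskidov 2008, proof of Thm. 4.1, run for the BMR
system). Let `U N` (`N ∈ ℕ`) solve the truncated systems `T_N^κ` (`κ ≥ 0`): `U N 0 ≡ 0`, modes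
`1, …, N` solve (1.1) on `[0, ∞)`, `U N (N+1) ≡ κ · U N N`, higher modes vanish, with a common
datum `xₙ ≥ 0`, `∑xₙ² < ∞` (`ν ≥ 0`, `β ≠ 0`). Then along a subsequence `φ`, `U (φ j) n t`
converges for every mode `n` and every `t ≥ 0` to `X n t`, where `X` is a weak solution of (1.1)
with datum `x` (BMR Def. 3.1) and `X 0 ≡ 0`. Proof: positivity and energy decay give
`|U N n t| ≤ (1+κ)(∑xₙ²)^{1/2}` and modewise Lipschitz bounds uniform in `N`; diagonal extraction
(`exists_subseq_tendsto`); the integral equations pass to the limit by dominated convergence; the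
limit modes are continuous, hence `C¹` and solve (1.1) by the fundamental theorem of calculus.
[cite: Cheskidov2008, §4 Thm. 4.1 (proof)] [cite: BarbatoMorandinRomito2011, §3.2] -/
theorem exists_weakSolution_of_truncated {ν β κ : ℝ} (hν : 0 ≤ ν) (hβ : β ≠ 0) (hκ : 0 ≤ κ)
    {x : ℕ → ℝ} (hx : ∀ n, 1 ≤ n → 0 ≤ x n) (hx2 : Summable fun n => x n ^ 2)
    {U : ℕ → ℕ → ℝ → ℝ} (hU0 : ∀ N t, U N 0 t = 0) (hUN1 : ∀ N t, U N (N + 1) t = κ * U N N t)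
    (hUgt : ∀ N n, N + 2 ≤ n → ∀ t, U N n t = 0) (hUinit : ∀ N, ∀ m < N, U N (m + 1) 0 = x (m + 1))
    (hUd : ∀ N, ∀ m < N, ∀ t, 0 ≤ t →
      HasDerivWithinAt (U N (m + 1)) (bmrRHS ν β (fun k => U N k t) (m + 1)) (Ici 0) t) :
    ∃ (φ : ℕ → ℕ) (X : ℕ → ℝ → ℝ), StrictMono φ ∧ IsBMRWeakSolution ν β x X ∧ (∀ t, X 0 t = 0) ∧
      ∀ n t, 0 ≤ t → Tendsto (fun j => U (φ j) n t) atTop (𝓝 (X n t)) := by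
  -- Step 1: continuity, positivity and the energy bound, uniformly in `N`
  have hUcontN : ∀ N, ContinuousOn (U N N) (Ici 0) := by
    intro N
    rcases Nat.eq_zero_or_pos N with h0 | hN
    · have : U N N = fun _ => 0 := by funext τ; rw [h0]; exact hU0 0 τ
      rw [this]; exact continuousOn_const
    · obtain ⟨M, hM⟩ : ∃ M, N = M + 1 := ⟨N - 1, by omega⟩
      intro τ hτ
      have := (hUd N M (by omega) τ hτ).continuousWithinAt
      rwa [← hM] at this
  have hUcontN1 : ∀ N, ContinuousOn (U N (N + 1)) (Ici 0) := by
    intro N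
    have : U N (N + 1) = fun τ => κ * U N N τ := funext (hUN1 N)
    rw [this]; exact continuousOn_const.mul (hUcontN N)
  have hUpos : ∀ N, ∀ m < N, ∀ t, 0 ≤ t → 0 ≤ U N (m + 1) t := fun N =>
    nonneg_of_modes hβ (hUd N) (hUcontN1 N) fun m hm => by
      rw [hUinit N m hm]; exact hx (m + 1) (by omega)
  have hUposN : ∀ N t, 0 ≤ t → 0 ≤ U N N t := by
    intro N t ht
    rcases Nat.eq_zero_or_pos N with h0 | hN
    · rw [h0, hU0]
    · obtain ⟨M, hM⟩ : ∃ M, N = M + 1 := ⟨N - 1, by omega⟩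
      have := hUpos N M (by omega) t ht
      rwa [← hM] at this
  have hUposN1 : ∀ N t, 0 ≤ t → 0 ≤ U N (N + 1) t := fun N t ht => by
    rw [hUN1]; exact mul_nonneg hκ (hUposN N t ht)
  have hUnonneg : ∀ N n t, 0 ≤ t → 0 ≤ U N n t := by
    intro N n t ht
    rcases Nat.eq_zero_or_pos n with rfl | hn
    · rw [hU0]
    obtain ⟨m, rfl⟩ : ∃ m, n = m + 1 := ⟨n - 1, by omega⟩
    by_cases hm : m < N
    · exact hUpos N m hm t ht
    by_cases hm' : m = N
    · subst hm'; exact hUposN1 m t ht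
    · rw [hUgt N (m + 1) (by omega)]
  set E0 : ℝ := ∑' n, x n ^ 2 with hE0
  have hE0nn : 0 ≤ E0 := tsum_nonneg fun n => sq_nonneg _
  have hxE : ∀ N, ∑ m ∈ Finset.range N, x (m + 1) ^ 2 ≤ E0 := by
    intro N
    calc ∑ m ∈ Finset.range N, x (m + 1) ^ 2 ≤ ∑' m, x (m + 1) ^ 2 :=
          ((summable_nat_add_iff 1).2 hx2).sum_le_tsum _ fun m _ => sq_nonneg _
      _ ≤ E0 := by rw [hE0, hx2.tsum_eq_zero_add]; linarith [sq_nonneg (x 0)]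
  have hEN : ∀ N t, 0 ≤ t → ∑ m ∈ Finset.range N, U N (m + 1) t ^ 2 ≤ E0 := by
    intro N t ht
    have h := energy_le_of_modes hβ (hUd N) (hUcontN1 N) (hUposN1 N) le_rfl ht (ν := ν)
    have hD : 0 ≤ ∫ τ in (0 : ℝ)..t, ∑ m ∈ Finset.range N, bmrLambda (m + 1) ^ 2 * U N (m + 1) τ ^ 2 :=
      intervalIntegral.integral_nonneg ht fun τ _ => Finset.sum_nonneg fun m _ => by positivity
    have hinit : ∑ m ∈ Finset.range N, U N (m + 1) 0 ^ 2 ≤ E0 := by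
      calc ∑ m ∈ Finset.range N, U N (m + 1) 0 ^ 2 = ∑ m ∈ Finset.range N, x (m + 1) ^ 2 :=
            Finset.sum_congr rfl fun m hm => by rw [hUinit N m (Finset.mem_range.1 hm)]
        _ ≤ E0 := hxE N
    nlinarith
  -- Step 2: the uniform sup bound `|U N n t| ≤ R`
  set R : ℝ := (1 + κ) * Real.sqrt E0 with hR
  have hR0 : 0 ≤ R := by positivity
  have hsqrt_le : Real.sqrt E0 ≤ R := by
    rw [hR]; nlinarith [Real.sqrt_nonneg E0]
  have hUsolved : ∀ N, ∀ m < N, ∀ t, 0 ≤ t → |U N (m + 1) t| ≤ Real.sqrt E0 := by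
    intro N m hm t ht
    refine Real.abs_le_sqrt ?_
    exact le_trans (Finset.single_le_sum (f := fun m => U N (m + 1) t ^ 2)
      (fun _ _ => sq_nonneg _) (Finset.mem_range.2 hm)) (hEN N t ht)
  have hUabsN : ∀ N t, 0 ≤ t → |U N N t| ≤ Real.sqrt E0 := by
    intro N t ht
    rcases Nat.eq_zero_or_pos N with h0 | hN
    · rw [h0, hU0, abs_zero]; exact Real.sqrt_nonneg _
    · obtain ⟨M, hM⟩ : ∃ M, N = M + 1 := ⟨N - 1, by omega⟩
      have := hUsolved N M (by omega) t ht
      rwa [← hM] at this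
  have hUabs : ∀ t, 0 ≤ t → ∀ N n, |U N n t| ≤ R := by
    intro t ht N n
    rcases Nat.eq_zero_or_pos n with rfl | hn
    · rw [hU0, abs_zero]; exact hR0
    obtain ⟨m, rfl⟩ : ∃ m, n = m + 1 := ⟨n - 1, by omega⟩
    by_cases hm : m < N
    · exact (hUsolved N m hm t ht).trans hsqrt_le
    by_cases hm' : m = N
    · subst hm'
      rw [hUN1, abs_mul, abs_of_nonneg hκ, hR]
      nlinarith [hUabsN m t ht, abs_nonneg (U m m t), Real.sqrt_nonneg E0]
    · rw [hUgt N (m + 1) (by omega), abs_zero]; exact hR0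
  -- Step 3: equi-Lipschitz bounds, mode by mode
  set L : ℕ → ℝ := fun m => ν * bmrLambda (m + 1) ^ 2 * R + bmrLambda m ^ β * R ^ 2 +
    bmrLambda (m + 1) ^ β * R ^ 2 with hL
  have hL0 : ∀ m, 0 ≤ L m := fun m => by
    have := bmrLambda_rpow_nonneg m β; have := bmrLambda_rpow_nonneg (m + 1) β
    simp only [hL]; positivity
  have hderiv_bd : ∀ N t, 0 ≤ t → ∀ m, |bmrRHS ν β (fun k => U N k t) (m + 1)| ≤ L m :=
    fun N t ht m => abs_bmrRHS_succ_le hν hR0 (fun k => hUabs t ht N k) m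
  have hlip_solved : ∀ N, ∀ m < N, ∀ s, 0 ≤ s → ∀ t, 0 ≤ t →
      |U N (m + 1) t - U N (m + 1) s| ≤ L m * |t - s| := by
    intro N m hm s hs t ht
    set T := max s t with hT
    have hd : ∀ τ ∈ Icc 0 T, HasDerivWithinAt (U N (m + 1))
        (bmrRHS ν β (fun k => U N k τ) (m + 1)) (Icc 0 T) τ :=
      fun τ hτ => (hUd N m hm τ hτ.1).mono Icc_subset_Ici_self
    have := Convex.norm_image_sub_le_of_norm_hasDerivWithin_le (C := L m) hd
      (fun τ hτ => by rw [Real.norm_eq_abs]; exact hderiv_bd N τ hτ.1 m) (convex_Icc 0 T)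
      ⟨hs, le_max_left s t⟩ ⟨ht, le_max_right s t⟩
    simpa [Real.norm_eq_abs] using this
  have hlipU : ∀ T, 0 ≤ T → ∀ n, ∃ L', ∀ N, ∀ s ∈ Icc 0 T, ∀ t ∈ Icc 0 T,
      |U N n t - U N n s| ≤ L' * |t - s| := by
    intro T _ n
    rcases Nat.eq_zero_or_pos n with rfl | hn
    · exact ⟨0, fun N s _ t _ => by simp [hU0]⟩
    obtain ⟨m, rfl⟩ : ∃ m, n = m + 1 := ⟨n - 1, by omega⟩
    refine ⟨L m + κ * L (m - 1), fun N s hs t ht => ?_⟩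
    have hκL : 0 ≤ κ * L (m - 1) * |t - s| := by have := hL0 (m - 1); positivity
    have hLm : 0 ≤ L m * |t - s| := by have := hL0 m; positivity
    by_cases hm : m < N
    · calc |U N (m + 1) t - U N (m + 1) s| ≤ L m * |t - s| := hlip_solved N m hm s hs.1 t ht.1
        _ ≤ (L m + κ * L (m - 1)) * |t - s| := by nlinarith
    by_cases hm' : m = N
    · subst hm'
      rw [hUN1, hUN1, ← mul_sub, abs_mul, abs_of_nonneg hκ]
      rcases Nat.eq_zero_or_pos m with h0 | hmpos
      · subst h0
        rw [hU0, hU0, sub_self, abs_zero, mul_zero]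
        exact mul_nonneg (add_nonneg (hL0 _) (mul_nonneg hκ (hL0 _))) (abs_nonneg _)
      · obtain ⟨j, rfl⟩ : ∃ j, m = j + 1 := ⟨m - 1, by omega⟩
        have h := hlip_solved (j + 1) j (by omega) s hs.1 t ht.1
        simp only [Nat.add_sub_cancel]
        calc κ * |U (j + 1) (j + 1) t - U (j + 1) (j + 1) s| ≤ κ * (L j * |t - s|) :=
              mul_le_mul_of_nonneg_left h hκ
          _ ≤ (L (j + 1) + κ * L j) * |t - s| := by nlinarith [hL0 (j + 1), abs_nonneg (t - s)]
    · rw [hUgt N (m + 1) (by omega), hUgt N (m + 1) (by omega), sub_self, abs_zero]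
      exact mul_nonneg (add_nonneg (hL0 _) (mul_nonneg hκ (hL0 _))) (abs_nonneg _)
  -- Step 4: extraction of a convergent subsequence
  obtain ⟨φ, hφ, hconv⟩ := exists_subseq_tendsto (R := fun _ => R)
    (fun t ht N n => hUabs t ht N n) hlipU
  set v : ℕ → ℝ → ℝ := fun n t => limUnder atTop fun j => U (φ j) n t with hv
  replace hconv : ∀ n t, 0 ≤ t → Tendsto (fun j => U (φ j) n t) atTop (𝓝 (v n t)) := hconv
  -- Step 5: first properties of the limit
  have hv0 : ∀ t, v 0 t = 0 := by
    intro t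
    have : (fun j => U (φ j) 0 t) = fun _ => 0 := funext fun j => hU0 _ _
    simp only [hv, this]
    exact tendsto_const_nhds.limUnder_eq
  have hvinit : ∀ n, 1 ≤ n → v n 0 = x n := by
    intro n hn
    obtain ⟨m, rfl⟩ : ∃ m, n = m + 1 := ⟨n - 1, by omega⟩
    refine tendsto_nhds_unique (hconv (m + 1) 0 le_rfl) (tendsto_const_nhds.congr' ?_)
    filter_upwards [hφ.tendsto_atTop.eventually (eventually_gt_atTop m)] with j hj
    exact (hUinit (φ j) m hj).symm
  have hvlip : ∀ T, 0 ≤ T → ∀ n, ∃ L', ∀ s ∈ Icc 0 T, ∀ t ∈ Icc 0 T,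
      |v n t - v n s| ≤ L' * |t - s| := by
    intro T hT n
    obtain ⟨L', hL'⟩ := hlipU T hT n
    exact ⟨L', fun s hs t ht => le_of_tendsto (((hconv n t ht.1).sub (hconv n s hs.1)).abs)
      (Eventually.of_forall fun j => hL' (φ j) s hs t ht)⟩
  have hvcontT : ∀ T, 0 ≤ T → ∀ n, ContinuousOn (v n) (Icc 0 T) := by
    intro T hT n
    obtain ⟨L', hL'⟩ := hvlip T hT n
    have : LipschitzOnWith (Real.toNNReal L') (v n) (Icc 0 T) :=
      LipschitzOnWith.of_dist_le_mul fun s hs t ht => by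
        rw [Real.dist_eq, Real.dist_eq]
        exact (hL' t ht s hs).trans
          (mul_le_mul_of_nonneg_right (Real.le_coe_toNNReal L') (abs_nonneg _))
    exact this.continuousOn
  have hvcont : ∀ n, ContinuousOn (v n) (Ici 0) := by
    intro n t ht
    have ht' : (0 : ℝ) ≤ t := ht
    have hmem : Icc 0 (t + 1) ∈ 𝓝[Ici 0] t :=
      Filter.mem_of_superset (inter_mem_nhdsWithin (Ici (0 : ℝ)) (Iio_mem_nhds (by linarith)))
        fun s hs => ⟨hs.1, hs.2.le⟩
    exact (hvcontT (t + 1) (by linarith) n t ⟨ht', by linarith⟩).mono_of_mem_nhdsWithin hmem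
  have hvmax : ∀ n, Continuous fun τ => v n (max τ 0) := fun n =>
    (hvcont n).comp_continuous (f := fun τ : ℝ => max τ 0) (continuous_id.max continuous_const)
      fun τ => Set.mem_Ici.2 (le_max_right τ 0)
  -- Step 6: the truncated equations in integral form
  have hUcont : ∀ N n T, ContinuousOn (U N n) (Icc 0 T) := by
    intro N n T
    rcases Nat.eq_zero_or_pos n with rfl | hn
    · have : U N 0 = fun _ => 0 := funext fun t => hU0 N t
      rw [this]; exact continuousOn_const
    obtain ⟨m, rfl⟩ : ∃ m, n = m + 1 := ⟨n - 1, by omega⟩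
    by_cases hm : m < N
    · exact fun t ht => ((hUd N m hm t ht.1).continuousWithinAt).mono Icc_subset_Ici_self
    by_cases hm' : m = N
    · subst hm'; exact (hUcontN1 m).mono Icc_subset_Ici_self
    · have : U N (m + 1) = fun _ => 0 := funext fun t => hUgt N (m + 1) (by omega) t
      rw [this]; exact continuousOn_const
  have hint : ∀ N, ∀ m < N, ∀ t, 0 ≤ t → U N (m + 1) t =
      x (m + 1) + ∫ τ in (0 : ℝ)..t, bmrRHS ν β (fun k => U N k τ) (m + 1) := by
    intro N m hm t ht
    have hcRHS : ContinuousOn (fun τ => bmrRHS ν β (fun k => U N k τ) (m + 1)) (Icc 0 t) :=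
      continuousOn_bmrRHS_succ (fun k => hUcont N k t) m
    have h := intervalIntegral.integral_eq_sub_of_hasDeriv_right_of_le ht (hUcont N (m + 1) t)
      (fun τ hτ => (hUd N m hm τ hτ.1.le).mono fun r hr => hτ.1.le.trans (le_of_lt hr))
      (hcRHS.intervalIntegrable_of_Icc ht)
    rw [h, hUinit N m hm]
    ring
  -- Step 7: passage to the limit in the integral form
  have hint_v : ∀ m t, 0 ≤ t → v (m + 1) t =
      x (m + 1) + ∫ τ in (0 : ℝ)..t, bmrRHS ν β (fun k => v k τ) (m + 1) := by
    intro m t ht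
    have h1 : Tendsto (fun j => U (φ j) (m + 1) t) atTop (𝓝 (v (m + 1) t)) := hconv _ t ht
    have h2 : Tendsto (fun j => x (m + 1) +
        ∫ τ in (0 : ℝ)..t, bmrRHS ν β (fun k => U (φ j) k τ) (m + 1)) atTop
        (𝓝 (x (m + 1) + ∫ τ in (0 : ℝ)..t, bmrRHS ν β (fun k => v k τ) (m + 1))) := by
      refine tendsto_const_nhds.add ?_
      refine intervalIntegral.tendsto_integral_filter_of_dominated_convergence (fun _ => L m)
        ?_ ?_ ?_ ?_
      · refine Eventually.of_forall fun j => ?_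
        have hc := continuousOn_bmrRHS_succ (ν := ν) (β := β) (m := m) (fun k => hUcont (φ j) k t)
        rw [uIoc_of_le ht]
        exact (hc.mono Ioc_subset_Icc_self).aestronglyMeasurable measurableSet_Ioc
      · refine Eventually.of_forall fun j => ae_of_all _ fun τ hτ => ?_
        rw [uIoc_of_le ht] at hτ
        rw [Real.norm_eq_abs]
        exact hderiv_bd (φ j) τ hτ.1.le m
      · exact intervalIntegrable_const
      · refine ae_of_all _ fun τ hτ => ?_
        rw [uIoc_of_le ht] at hτ
        exact tendsto_bmrRHS_succ (fun k => hconv k τ hτ.1.le) m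
    have h3 : ∀ᶠ j in atTop, U (φ j) (m + 1) t =
        x (m + 1) + ∫ τ in (0 : ℝ)..t, bmrRHS ν β (fun k => U (φ j) k τ) (m + 1) := by
      filter_upwards [hφ.tendsto_atTop.eventually (eventually_gt_atTop m)] with j hj
      exact hint (φ j) m hj t ht
    exact tendsto_nhds_unique (h1.congr' h3) h2
  -- Step 8: differentiate the integral form
  have hderiv_v : ∀ m t, 0 ≤ t → HasDerivWithinAt (v (m + 1))
      (bmrRHS ν β (fun k => v k t) (m + 1)) (Ici 0) t := by
    intro m t ht
    set f : ℝ → ℝ := fun τ => bmrRHS ν β (fun k => v k (max τ 0)) (m + 1) with hf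
    have hfc : Continuous f := continuous_bmrRHS_succ hvmax m
    have hΦ : HasDerivAt (fun s => x (m + 1) + ∫ τ in (0 : ℝ)..s, f τ) (f t) t :=
      (intervalIntegral.integral_hasDerivAt_right (hfc.intervalIntegrable 0 t)
        (hfc.stronglyMeasurableAtFilter _ _) hfc.continuousAt).const_add _
    have heq : ∀ s ∈ Ici (0 : ℝ), v (m + 1) s = x (m + 1) + ∫ τ in (0 : ℝ)..s, f τ := by
      intro s hs
      have hs' : (0 : ℝ) ≤ s := hs
      rw [hint_v m s hs']
      congr 1
      refine intervalIntegral.integral_congr fun τ hτ => ?_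
      rw [uIcc_of_le hs'] at hτ
      simp only [hf, max_eq_left hτ.1]
    have hft : f t = bmrRHS ν β (fun k => v k t) (m + 1) := by
      simp only [hf, max_eq_left ht]
    rw [← hft]
    exact hΦ.hasDerivWithinAt.congr (fun s hs => heq s hs) (heq t ht)
  -- conclusion
  refine ⟨φ, v, hφ, ⟨hvinit, fun n hn t ht => ?_⟩, hv0, hconv⟩
  obtain ⟨m, rfl⟩ : ∃ m, n = m + 1 := ⟨n - 1, by omega⟩
  exact hderiv_v m t ht

/-! ## Global existence of weak solutions -/

/-- **Global existence of weak solutions for non-negative `ℓ²` data** (the first fact that BMR §3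
take from Cheskidov 2008, Thm. 4.1 — "existence of global in time Leray–Hopf solutions for all
initial conditions in `H`" — in the non-negative case used by Theorem 1): for `ν ≥ 0`, `β ≠ 0`
and a datum with `xₙ ≥ 0` (`n ≥ 1`), `∑xₙ² < ∞`, the viscous dyadic model (1.1) has a weak
solution on `[0, ∞)` (BMR Def. 3.1) with `X₀ ≡ 0`; by `DyadicCascadePositivity` it is
non-negative, `ℓ²`-valued and obeys the energy inequality from every time (a Leray–Hopf solution).
Proof: Galerkin truncations `T_N^0` (`exists_truncated_solution`) and the passage to the limit
`exists_weakSolution_of_truncated`. [cite: Cheskidov2008, §4 Thm. 4.1] [cite: BarbatoMorandinRomito2011, §3] -/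
theorem exists_isBMRWeakSolution {ν β : ℝ} (hν : 0 ≤ ν) (hβ : β ≠ 0) {x : ℕ → ℝ}
    (hx : ∀ n, 1 ≤ n → 0 ≤ x n) (hx2 : Summable fun n => x n ^ 2) :
    ∃ X : ℕ → ℝ → ℝ, IsBMRWeakSolution ν β x X ∧ ∀ t, X 0 t = 0 := by
  choose U hU0 hUN1 hUgt hUinit hUd using
    fun N => exists_truncated_solution (κ := 0) hν hβ le_rfl x hx N
  obtain ⟨φ, X, -, hX, hX0, -⟩ := exists_weakSolution_of_truncated hν hβ le_rfl hx hx2 hU0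
    hUN1 hUgt hUinit hUd
  exact ⟨X, hX, hX0⟩

end Literature.Barriers.NavierStokesRegularity.Dyadic
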